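/-
Copyright: the b2b-balaban T⁴-continuum CRUX team, row NE7b leaf lineage `t4-ne7b-formalise-leaf-04` (gen 153). Project licence.
-/
import Mathlib.Analysis.Calculus.FDeriv.Comp
import Mathlib.Analysis.Calculus.FDeriv.Congr
import Mathlib.Analysis.Calculus.FDeriv.Const
import Mathlib.Analysis.Calculus.FDeriv.Linear
import Mathlib.Analysis.Normed.Operator.Bilinear

/-!
# THE NEXT ACTION'S HESSIAN IS THE TRANSPORTED HESSIAN, WITH `σ ∈ C¹` ONLY:
# `(V ∘ σ)″(w) = V″(σ w)[σ′(w)·, σ′(w)·]` in `HasFDerivAt` currency along the whole critical branch — the displayed identity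
# `hW` of `…HardStepTransportedLetters` (HSTL) DISCHARGED from `…HardStepBranchDeriv`'s letters (`D ∘ σ′ = 1`, `σ` differentiable
# near `w`) and fibre-criticality (`DV(σ ·)` kills `ker D`), Mathlib only
# (row NE7b, node U5c; TRANSFER rows (ix)∕(xxiv): King CMP 102 (2.14) «the effective Laplacian of the average field», [B11] CMP 102
# p. 307 (182)–(190) «δ∕δB ℋ … like the propagator»; [folklore] — the second-order envelope theorem along a `C¹` branch)

Cell `pub-balaban`, sub-cell `t4`, spine estimate NE7b (`T4WeightBudget.RelWeightBound`; the cell's OWN estimate — NOT PRINTED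
in [Bałaban 1983–89], NOT PROVED).  Crux-route work under `Spine/NE7b/` by leaf-04 (CRUX team (2), FREEZE (0) crux-prover clause).
NOTHING of Bałaban's is named, asserted, valued or discharged; no `T4Continuum/Support` leaf typed; no `def`; zero `sorry`.  Imports
Mathlib ONLY (chain rule, `bilinearComp`) — independent of the `Spine/NE7b` olean frontier; the conclusions of HSCR (criticality of
`σ w′`), HSBD (`σ` differentiable near `w`, `D ∘ σ′(w′) = 1`) and the twice-differentiability of `V` AT `σ w` enter as displayed
hypotheses — letters in, letters out; nothing of HSCR ∕ HSBD ∕ HSTL ∕ leaf-03's `…ConstrainedMinimiserRegular` (CMR) ∕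
`…ConstrainedValueHessian` (CVH) is imported or restated.

WHY.  The chart chain AHE → HSCR → HSBD → HSBDM → HSTL (leaf-03 ∕ leaf-04 ∕ leaf-06, all [folklore], all letters displayed) runs from
kernel coercivity to the NEXT scale's moduli, but HSTL's second-order END is stated UNDER a displayed identity
`hW : W″ w = V″(σ w).bilinearComp (σ′ w) (σ′ w)` for «the» Hessian `W″` of the next action `V⁺ = V ∘ σ`, honestly left to the value
side.  The value side (CMR: `φ ∈ C^{n+1}` qualitatively, finite dimension; CVS ∕ CVH: the second-order term of `φ = inf V` at the base
point in Peano currency is the constrained Schur form) does not state `hW` either.  The point typed here: `hW` needs NO second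
derivative of `σ`.  Since `DV(σ w′)` kills `ker D` and `σ′(w′) − σ′(w)` maps into `ker D` (both are right inverses of `D`),
`D(V ∘ σ)(w′) = DV(σ w′) ∘ σ′(w)` with the FIXED operator `σ′(w)` for every `w′` near `w` (CMR's envelope formula with `M := σ′(w)`;
re-derived inline from a two-line linear-algebra lemma, not imported); the right side is differentiable at `w` by the chain rule as
soon as `V` is twice differentiable at `σ w` and `σ` once at `w`, with derivative `k ↦ V″(σ w)(σ′(w) k) ∘ σ′(w)` — which IS
`V″(σ w).bilinearComp (σ′ w) (σ′ w)`.  No propagator letter, no symmetry of `V″`, no convexity, no minimality, no finite dimension.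
Consequences displayed for HSTL ∕ HSCR at the next scale: the `fderiv` form, the graph formula `(V⁺)″ k k′ = V″(σ′k)(σ′k′)`, and the
two-sided letters — a floor `m‖v‖²` for `V″(σ w)` on the graph directions gives `(V⁺)″ k k ≥ m‖σ′(w)k‖² ≥ (m∕q²)‖k‖²` whenever
`‖D‖ ≤ q` (as `k = D(σ′k)`), and `‖(V⁺)″‖ ≤ ‖V″(σ w)‖·‖σ′(w)‖²` (HSBD: `≤ B·(N⁻¹ − c)⁻²`).

WHAT IS PROVED ([folklore]; the second-order envelope theorem, e.g. Bonnans–Shapiro, *Perturbation Analysis of Optimization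
Problems* (2000) §4.7, Fiacco (1983) §3.2 — there for minimisers in finite dimension; here for critical branches in Banach spaces
with `σ ∈ C¹`; nothing cited as a fact; nearest tree items: CMR `hasFDerivAt_comp_branch` (FIRST order, the `HasFDerivAt` form of
§1's use — not restated: §1 is the linear-algebra identity behind it), CVH `isLittleO_constrValue_hessian` (Peano, base point, value
function), HSTL (consumes `hW`)).
* §1 `comp_eq_comp_of_rightInverse` (a functional killing `ker D` reads the same through ANY two right inverses of `D`),
  `fderiv_comp_eq_comp_fixed` (hence `fderiv (V ∘ σ) w′ = DV(σ w′) ∘ P` for a fixed right inverse `P`, at every `w′` where the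
  branch letters hold — `fderiv` currency).
* §2 THE END **`hasFDerivAt_fderiv_comp_branch`**: `s ∈ 𝓝 w`; on `s`: `HasFDerivAt σ (σ′ w′) w′`, `D(σ′ w′ k) = k`, `V` differentiable
  at `σ w′` with `DV(σ w′) κ = 0` for `D κ = 0`; AT `σ w`: `HasFDerivAt (fderiv ℝ V) V″ (σ w)` ⟹
  `HasFDerivAt (fderiv ℝ (V ∘ σ)) (V″.bilinearComp (σ′ w) (σ′ w)) w`.
* §3 `fderiv_fderiv_comp_branch` (`fderiv` form), `hessian_comp_branch_apply` (`(V⁺)″ k k′ = V″ (σ′ w k) (σ′ w k′)`),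
  **`le_hessian_comp_branch`** (`m‖v‖² ≤ V″ v v` ⟹ `m‖σ′ w k‖² ≤ (V⁺)″ k k`), `norm_le_mul_norm_apply_of_rightInverse`
  (`D(σ′k) = k`, `‖D‖ ≤ q` ⟹ `‖k‖ ≤ q‖σ′ k‖`), **`floor_hessian_comp_branch`** (`(m∕q²)‖k‖² ≤ (V⁺)″ k k`, `0 ≤ m`, `0 < q`),
  **`norm_hessian_comp_branch_le`** (`‖(V⁺)″‖ ≤ ‖V″‖·‖σ′ w‖²`).
* §4 IN HSBD ∕ HSCR's CONCLUSION SHAPE **`hasFDerivAt_fderiv_comp_criticalBranch`**: on `ball w₀ ρ`, `σ` differentiable with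
  `D (fderiv σ w′ k) = k` (HSBD §5: `D ∘ (A⁻¹ ∘ inl) = 1` + `HasFDerivAt.fderiv`) and `fderiv V (σ w′) κ = 0` on `ker D` (HSCR), `V`
  differentiable on the fibre ball, `HasFDerivAt (fderiv V) (V″ (σ w)) (σ w)` ⟹
  `HasFDerivAt (fderiv (V ∘ σ)) ((V″ (σ w)).bilinearComp (fderiv σ w) (fderiv σ w)) w` — HSTL's `hW` with
  `W″ w := (V″ (σ w)).bilinearComp (fderiv σ w) (fderiv σ w)` now a THEOREM about `fderiv (fderiv (V ∘ σ))`.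
* §5 toy (`example`): `E = F = ℝ`, `D = 1`, `σ = id`, `V = 0`.

NOT HERE (honest): `σ ∈ C²` (not needed); continuity ∕ modulus of `w ↦ (V⁺)″(w)` (HSTL, from HSBDM); the identification with the
value function `inf_{Dδ = w} V` (CMR `criticalBranch_isMinOn` ∕ CVH, convex case); which `V, D, σ` are Bałaban's ((A3) ∕ (A1c),
NC-NE7b-α UNRULED); anything of Bałaban's.  BY-NAME EFFECT ON THE WALL: NONE.  NE7b NOT PRINTED ∕ NOT PROVED; spine PROVED 0∕9; rung
(B)+1 on a FINITE torus — NOT infinite volume, NOT the mass gap, NOT Clay.  HONEST DEPENDENCY: continuum YM on T⁴ ⇐ BetaPertH ∧ nine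
spine estimates (0/9 proved); BetaPertH ⇐ (D1) ∧ (D4) ∧ CAP+tail; G-an2-4 gates asym, D1 and NE2∕3∕4.
-/

set_option autoImplicit false

noncomputable section

namespace Summit.QuantumFields.BalabanUV.T4Continuum.NE7b.HardStepActionHessian

open Set Filter Topology Function Metric

variable {E F : Type*} [NormedAddCommGroup E] [NormedSpace ℝ E] [NormedAddCommGroup F] [NormedSpace ℝ F]

/-! ## §1. A functional killing `ker D` reads the same through any two right inverses of `D` -/

/-- `L κ = 0` on `ker D`, `D (S k) = k`, `D (P k) = k` ⟹ `L ∘ S = L ∘ P` (the difference `S k − P k` lies in `ker D`).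
[folklore] -/
theorem comp_eq_comp_of_rightInverse (D : E →L[ℝ] F) (L : E →L[ℝ] ℝ) (hL : ∀ κ : E, D κ = 0 → L κ = 0)
    (S P : F →L[ℝ] E) (hS : ∀ k, D (S k) = k) (hP : ∀ k, D (P k) = k) : L.comp S = L.comp P := by
  ext k
  have hk : D (S k - P k) = 0 := by rw [map_sub, hS, hP, sub_self]
  have h0 := hL _ hk
  rw [map_sub, sub_eq_zero] at h0
  simpa using h0

/-- **`fderiv (V ∘ σ) w′ = DV(σ w′) ∘ P` FOR A FIXED RIGHT INVERSE `P`**: at a point `w′` where `σ` has derivative `σ′` with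
`D ∘ σ′ = 1`, `V` is differentiable at `σ w′` and `DV(σ w′)` kills `ker D`, the derivative of `V ∘ σ` is `DV(σ w′) ∘ P` for ANY
right inverse `P` of `D` (chain rule + §1). [folklore] -/
theorem fderiv_comp_eq_comp_fixed (D : E →L[ℝ] F) {V : E → ℝ} {σ : F → E} {σ' : F →L[ℝ] E} (P : F →L[ℝ] E)
    (hP : ∀ k, D (P k) = k) {w' : F} (hσ : HasFDerivAt σ σ' w') (hσ' : ∀ k, D (σ' k) = k)
    (hV : DifferentiableAt ℝ V (σ w')) (hcrit : ∀ κ : E, D κ = 0 → fderiv ℝ V (σ w') κ = 0) :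
    fderiv ℝ (V ∘ σ) w' = (fderiv ℝ V (σ w')).comp P := by
  rw [fderiv_comp w' hV hσ.differentiableAt, hσ.fderiv]
  exact comp_eq_comp_of_rightInverse D _ hcrit σ' P hσ' hP

/-! ## §2. THE END: the Hessian of the next action along a `C¹` critical branch -/

/-- **THE NEXT ACTION'S HESSIAN IS THE TRANSPORTED HESSIAN, `σ ∈ C¹` ONLY.**  Let `s ∈ 𝓝 w`; on `s` let `σ` have derivative
`σ′ w′` with `D (σ′ w′ k) = k`, and let `V` be differentiable at `σ w′` with `DV(σ w′) κ = 0` for `D κ = 0` (fibre-criticality);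
at `σ w` let `V` be twice differentiable, `HasFDerivAt (fderiv ℝ V) V″ (σ w)`.  Then
`HasFDerivAt (fderiv ℝ (V ∘ σ)) (V″.bilinearComp (σ′ w) (σ′ w)) w` — i.e. `(V ∘ σ)″(w) k k′ = V″ (σ′(w) k) (σ′(w) k′)`.
Proof: near `w`, `fderiv (V ∘ σ) = (DV ∘ σ) ∘ σ′(w)` with the FIXED `σ′(w)` (§1); differentiate the right side by the chain rule.
[folklore] -/
theorem hasFDerivAt_fderiv_comp_branch (D : E →L[ℝ] F) {V : E → ℝ} {V'' : E →L[ℝ] E →L[ℝ] ℝ} {σ : F → E}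
    {σ' : F → F →L[ℝ] E} {s : Set F} {w : F} (hs : s ∈ 𝓝 w)
    (hσ : ∀ w' ∈ s, HasFDerivAt σ (σ' w') w') (hσ' : ∀ w' ∈ s, ∀ k, D (σ' w' k) = k)
    (hV : ∀ w' ∈ s, DifferentiableAt ℝ V (σ w'))
    (hcrit : ∀ w' ∈ s, ∀ κ : E, D κ = 0 → fderiv ℝ V (σ w') κ = 0)
    (hV2 : HasFDerivAt (fderiv ℝ V) V'' (σ w)) :
    HasFDerivAt (fderiv ℝ (V ∘ σ)) (V''.bilinearComp (σ' w) (σ' w)) w := by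
  have hw : w ∈ s := mem_of_mem_nhds hs
  -- the fixed right inverse `P := σ′(w)` and the precomposition operator `L ↦ L ∘ P`
  set P : F →L[ℝ] E := σ' w with hP
  set R : (E →L[ℝ] ℝ) →L[ℝ] (F →L[ℝ] ℝ) := (ContinuousLinearMap.compL ℝ F E ℝ).flip P with hR
  have hRapply : ∀ L : E →L[ℝ] ℝ, R L = L.comp P := fun L => rfl
  -- near `w`: `fderiv (V ∘ σ) w′ = R (fderiv V (σ w′))`
  have heq : (fun w' => R (fderiv ℝ V (σ w'))) =ᶠ[𝓝 w] fderiv ℝ (V ∘ σ) := by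
    filter_upwards [hs] with w' hw'
    rw [hRapply, fderiv_comp_eq_comp_fixed D P (hσ' w hw) (hσ w' hw') (hσ' w' hw') (hV w' hw') (hcrit w' hw')]
  -- the right side is differentiable at `w` by the chain rule
  have hchain : HasFDerivAt (fun w' => fderiv ℝ V (σ w')) (V''.comp (σ' w)) w := hV2.comp w (hσ w hw)
  have hR' : HasFDerivAt (fun w' => R (fderiv ℝ V (σ w'))) (R.comp (V''.comp (σ' w))) w :=
    R.hasFDerivAt.comp w hchain
  have hfinal := hR'.congr_of_eventuallyEq heq.symm
  -- identify the derivative with the transported form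
  have hident : R.comp (V''.comp (σ' w)) = V''.bilinearComp (σ' w) (σ' w) := by
    ext k k'
    rw [ContinuousLinearMap.comp_apply, ContinuousLinearMap.comp_apply, hRapply, ContinuousLinearMap.comp_apply,
      ContinuousLinearMap.bilinearComp_apply, hP]
  rw [← hident]
  exact hfinal

/-! ## §3. Consequences: the `fderiv` form, the graph formula, two-sided letters -/

section Consequences

variable (D : E →L[ℝ] F) {V : E → ℝ} {V'' : E →L[ℝ] E →L[ℝ] ℝ} {σ : F → E} {σ' : F → F →L[ℝ] E} {s : Set F} {w : F}

/-- The `fderiv` form: `fderiv (fderiv (V ∘ σ)) w = V″.bilinearComp (σ′ w) (σ′ w)`. [folklore] -/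
theorem fderiv_fderiv_comp_branch (hs : s ∈ 𝓝 w)
    (hσ : ∀ w' ∈ s, HasFDerivAt σ (σ' w') w') (hσ' : ∀ w' ∈ s, ∀ k, D (σ' w' k) = k)
    (hV : ∀ w' ∈ s, DifferentiableAt ℝ V (σ w'))
    (hcrit : ∀ w' ∈ s, ∀ κ : E, D κ = 0 → fderiv ℝ V (σ w') κ = 0)
    (hV2 : HasFDerivAt (fderiv ℝ V) V'' (σ w)) :
    fderiv ℝ (fderiv ℝ (V ∘ σ)) w = V''.bilinearComp (σ' w) (σ' w) :=
  (hasFDerivAt_fderiv_comp_branch D hs hσ hσ' hV hcrit hV2).fderiv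

/-- **THE GRAPH FORMULA**: `(V ∘ σ)″(w) k k′ = V″ (σ′(w) k) (σ′(w) k′)`. [folklore] -/
theorem hessian_comp_branch_apply (hs : s ∈ 𝓝 w)
    (hσ : ∀ w' ∈ s, HasFDerivAt σ (σ' w') w') (hσ' : ∀ w' ∈ s, ∀ k, D (σ' w' k) = k)
    (hV : ∀ w' ∈ s, DifferentiableAt ℝ V (σ w'))
    (hcrit : ∀ w' ∈ s, ∀ κ : E, D κ = 0 → fderiv ℝ V (σ w') κ = 0)
    (hV2 : HasFDerivAt (fderiv ℝ V) V'' (σ w)) (k k' : F) :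
    fderiv ℝ (fderiv ℝ (V ∘ σ)) w k k' = V'' (σ' w k) (σ' w k') := by
  rw [fderiv_fderiv_comp_branch D hs hσ hσ' hV hcrit hV2, ContinuousLinearMap.bilinearComp_apply]

/-- **FLOOR TRANSPORT ALONG THE GRAPH**: a floor `m‖v‖² ≤ V″ v v` (for all `v`, or at least on the graph directions `σ′(w) k`)
gives `m‖σ′(w) k‖² ≤ (V ∘ σ)″(w) k k`. [folklore] -/
theorem le_hessian_comp_branch (hs : s ∈ 𝓝 w)
    (hσ : ∀ w' ∈ s, HasFDerivAt σ (σ' w') w') (hσ' : ∀ w' ∈ s, ∀ k, D (σ' w' k) = k)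
    (hV : ∀ w' ∈ s, DifferentiableAt ℝ V (σ w'))
    (hcrit : ∀ w' ∈ s, ∀ κ : E, D κ = 0 → fderiv ℝ V (σ w') κ = 0)
    (hV2 : HasFDerivAt (fderiv ℝ V) V'' (σ w)) {m : ℝ} (hfloor : ∀ k : F, m * ‖σ' w k‖ ^ 2 ≤ V'' (σ' w k) (σ' w k))
    (k : F) : m * ‖σ' w k‖ ^ 2 ≤ fderiv ℝ (fderiv ℝ (V ∘ σ)) w k k := by
  rw [hessian_comp_branch_apply D hs hσ hσ' hV hcrit hV2]
  exact hfloor k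

omit [NormedSpace ℝ E] [NormedSpace ℝ F] in
/-- `D (S k) = k` and `‖D x‖ ≤ q‖x‖` give `‖k‖ ≤ q·‖S k‖`: the graph direction is at least `q⁻¹` times the kept one. [folklore] -/
theorem norm_le_mul_norm_apply_of_rightInverse {E' F' : Type*} [NormedAddCommGroup E'] [NormedAddCommGroup F']
    {D' : E' → F'} {S : F' → E'} {q : ℝ} (hD : ∀ x, ‖D' x‖ ≤ q * ‖x‖) (hS : ∀ k, D' (S k) = k) (k : F') :
    ‖k‖ ≤ q * ‖S k‖ := by
  have h := hD (S k)
  rwa [hS] at h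

/-- **THE NEXT SCALE'S FLOOR FROM THIS SCALE'S**: `m‖v‖² ≤ V″ v v` on the graph directions, `0 ≤ m`, `‖D x‖ ≤ q‖x‖` with `0 < q`
⟹ `(m∕q²)‖k‖² ≤ (V ∘ σ)″(w) k k` — the constrained modulus `m∕q²` (the value side's `γ∕q²` of `…ConstrainedSchurForm` §2, here
along the branch in derivative currency). [folklore] -/
theorem floor_hessian_comp_branch (hs : s ∈ 𝓝 w)
    (hσ : ∀ w' ∈ s, HasFDerivAt σ (σ' w') w') (hσ' : ∀ w' ∈ s, ∀ k, D (σ' w' k) = k)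
    (hV : ∀ w' ∈ s, DifferentiableAt ℝ V (σ w'))
    (hcrit : ∀ w' ∈ s, ∀ κ : E, D κ = 0 → fderiv ℝ V (σ w') κ = 0)
    (hV2 : HasFDerivAt (fderiv ℝ V) V'' (σ w)) {m q : ℝ} (hm : 0 ≤ m) (hq : 0 < q)
    (hDq : ∀ x : E, ‖D x‖ ≤ q * ‖x‖)
    (hfloor : ∀ k : F, m * ‖σ' w k‖ ^ 2 ≤ V'' (σ' w k) (σ' w k)) (k : F) :
    m / q ^ 2 * ‖k‖ ^ 2 ≤ fderiv ℝ (fderiv ℝ (V ∘ σ)) w k k := by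
  have hw : w ∈ s := mem_of_mem_nhds hs
  have hk : ‖k‖ ≤ q * ‖σ' w k‖ :=
    norm_le_mul_norm_apply_of_rightInverse (D' := D) (S := σ' w) hDq (hσ' w hw) k
  have hk2 : ‖k‖ ^ 2 ≤ q ^ 2 * ‖σ' w k‖ ^ 2 := by
    rw [← mul_pow]
    exact pow_le_pow_left₀ (norm_nonneg _) hk 2
  calc m / q ^ 2 * ‖k‖ ^ 2 ≤ m / q ^ 2 * (q ^ 2 * ‖σ' w k‖ ^ 2) :=
        mul_le_mul_of_nonneg_left hk2 (by positivity)
    _ = m * ‖σ' w k‖ ^ 2 := by field_simp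
    _ ≤ fderiv ℝ (fderiv ℝ (V ∘ σ)) w k k := le_hessian_comp_branch D hs hσ hσ' hV hcrit hV2 hfloor k

/-- **THE NEXT SCALE'S HESSIAN BOUND**: `‖(V ∘ σ)″(w)‖ ≤ ‖V″‖·‖σ′(w)‖²` (HSBD: `‖σ′(w)‖ ≤ (N⁻¹ − c)⁻¹`). [folklore] -/
theorem norm_hessian_comp_branch_le (hs : s ∈ 𝓝 w)
    (hσ : ∀ w' ∈ s, HasFDerivAt σ (σ' w') w') (hσ' : ∀ w' ∈ s, ∀ k, D (σ' w' k) = k)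
    (hV : ∀ w' ∈ s, DifferentiableAt ℝ V (σ w'))
    (hcrit : ∀ w' ∈ s, ∀ κ : E, D κ = 0 → fderiv ℝ V (σ w') κ = 0)
    (hV2 : HasFDerivAt (fderiv ℝ V) V'' (σ w)) :
    ‖fderiv ℝ (fderiv ℝ (V ∘ σ)) w‖ ≤ ‖V''‖ * ‖σ' w‖ ^ 2 := by
  rw [fderiv_fderiv_comp_branch D hs hσ hσ' hV hcrit hV2]
  refine ContinuousLinearMap.opNorm_le_bound _ (by positivity) fun k => ?_
  refine ContinuousLinearMap.opNorm_le_bound _ (by positivity) fun k' => ?_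
  rw [ContinuousLinearMap.bilinearComp_apply]
  calc ‖V'' (σ' w k) (σ' w k')‖ ≤ ‖V'' (σ' w k)‖ * ‖σ' w k'‖ := ContinuousLinearMap.le_opNorm _ _
    _ ≤ ‖V''‖ * ‖σ' w k‖ * (‖σ' w‖ * ‖k'‖) :=
        mul_le_mul (ContinuousLinearMap.le_opNorm _ _) (ContinuousLinearMap.le_opNorm _ _) (norm_nonneg _)
          (mul_nonneg (norm_nonneg V'') (norm_nonneg (σ' w k)))
    _ ≤ ‖V''‖ * (‖σ' w‖ * ‖k‖) * (‖σ' w‖ * ‖k'‖) := by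
        gcongr
        exact ContinuousLinearMap.le_opNorm _ _
    _ = ‖V''‖ * ‖σ' w‖ ^ 2 * ‖k‖ * ‖k'‖ := by ring

end Consequences

/-! ## §4. In HSBD ∕ HSCR's conclusion shape: HSTL's `hW` is a theorem -/

/-- **HSTL's DISPLAYED IDENTITY `hW` ON THE CRITICAL BRANCH.**  On `ball w₀ ρ` let `σ` be differentiable with
`D (fderiv σ w′ k) = k` (HSBD `hasFDerivAt_criticalBranch_of_chart(_ker)`: `HasFDerivAt σ (A⁻¹ ∘ inl) w′` and `D ∘ (A⁻¹ ∘ inl) = 1`,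
read through `HasFDerivAt.fderiv`) and fibre-critical (`fderiv V (σ w′) κ = 0` for `D κ = 0` — HSCR's conclusion), with `V`
differentiable at `σ w′`; at `σ w` let `HasFDerivAt (fderiv V) (V″ (σ w)) (σ w)`.  Then for every `w ∈ ball w₀ ρ`:
`HasFDerivAt (fderiv ℝ (V ∘ σ)) ((V″ (σ w)).bilinearComp (fderiv ℝ σ w) (fderiv ℝ σ w)) w` — HSTL's `W″ w` IS the second
derivative of `V ∘ σ`. [folklore] -/
theorem hasFDerivAt_fderiv_comp_criticalBranch (D : E →L[ℝ] F) {V : E → ℝ} {V'' : E → E →L[ℝ] E →L[ℝ] ℝ} {σ : F → E}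
    {w₀ : F} {ρ : ℝ}
    (hσd : ∀ w' ∈ ball w₀ ρ, DifferentiableAt ℝ σ w')
    (hσD : ∀ w' ∈ ball w₀ ρ, ∀ k, D (fderiv ℝ σ w' k) = k)
    (hVd : ∀ w' ∈ ball w₀ ρ, DifferentiableAt ℝ V (σ w'))
    (hcrit : ∀ w' ∈ ball w₀ ρ, ∀ κ : E, D κ = 0 → fderiv ℝ V (σ w') κ = 0)
    {w : F} (hw : w ∈ ball w₀ ρ) (hV2 : HasFDerivAt (fderiv ℝ V) (V'' (σ w)) (σ w)) :
    HasFDerivAt (fderiv ℝ (V ∘ σ)) ((V'' (σ w)).bilinearComp (fderiv ℝ σ w) (fderiv ℝ σ w)) w :=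
  hasFDerivAt_fderiv_comp_branch D (isOpen_ball.mem_nhds hw) (fun w' hw' => (hσd w' hw').hasFDerivAt) hσD hVd hcrit hV2

/-- The same in `fderiv` currency with the graph floor: `m‖v‖² ≤ V″(σ w) v v` on the graph directions, `‖D x‖ ≤ q‖x‖`, `0 ≤ m`,
`0 < q` ⟹ `(m∕q²)‖k‖² ≤ (V ∘ σ)″(w) k k` at every `w ∈ ball w₀ ρ`. [folklore] -/
theorem floor_hessian_comp_criticalBranch (D : E →L[ℝ] F) {V : E → ℝ} {V'' : E → E →L[ℝ] E →L[ℝ] ℝ} {σ : F → E}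
    {w₀ : F} {ρ : ℝ}
    (hσd : ∀ w' ∈ ball w₀ ρ, DifferentiableAt ℝ σ w')
    (hσD : ∀ w' ∈ ball w₀ ρ, ∀ k, D (fderiv ℝ σ w' k) = k)
    (hVd : ∀ w' ∈ ball w₀ ρ, DifferentiableAt ℝ V (σ w'))
    (hcrit : ∀ w' ∈ ball w₀ ρ, ∀ κ : E, D κ = 0 → fderiv ℝ V (σ w') κ = 0)
    {w : F} (hw : w ∈ ball w₀ ρ) (hV2 : HasFDerivAt (fderiv ℝ V) (V'' (σ w)) (σ w))
    {m q : ℝ} (hm : 0 ≤ m) (hq : 0 < q) (hDq : ∀ x : E, ‖D x‖ ≤ q * ‖x‖)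
    (hfloor : ∀ k : F, m * ‖fderiv ℝ σ w k‖ ^ 2 ≤ V'' (σ w) (fderiv ℝ σ w k) (fderiv ℝ σ w k)) (k : F) :
    m / q ^ 2 * ‖k‖ ^ 2 ≤ fderiv ℝ (fderiv ℝ (V ∘ σ)) w k k :=
  floor_hessian_comp_branch D (isOpen_ball.mem_nhds hw) (fun w' hw' => (hσd w' hw').hasFDerivAt) hσD hVd hcrit hV2
    hm hq hDq hfloor k

/-! ## §5. Toy -/

/-- Toy: `E = F = ℝ`, `D = id`, `σ = id` (`σ′ = id`, a right inverse of `id`), `V = 0` (`V″ = 0`): the next action `0 ∘ id` has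
Hessian `0.bilinearComp id id` at `0`. [folklore] -/
example : HasFDerivAt (fderiv ℝ ((fun _ : ℝ => (0 : ℝ)) ∘ id))
    ((0 : ℝ →L[ℝ] ℝ →L[ℝ] ℝ).bilinearComp (ContinuousLinearMap.id ℝ ℝ) (ContinuousLinearMap.id ℝ ℝ)) (0 : ℝ) := by
  refine hasFDerivAt_fderiv_comp_branch (ContinuousLinearMap.id ℝ ℝ) (s := univ) (σ' := fun _ => ContinuousLinearMap.id ℝ ℝ)
    univ_mem (fun w' _ => hasFDerivAt_id w') (fun _ _ k => rfl) (fun _ _ => differentiableAt_const _)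
    (fun _ _ κ hκ => by simp) ?_
  have h : fderiv ℝ (fun _ : ℝ => (0 : ℝ)) = fun _ => 0 := by
    ext x
    simp
  rw [h]
  exact hasFDerivAt_const _ _

end Summit.QuantumFields.BalabanUV.T4Continuum.NE7b.HardStepActionHessian

end
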